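import Summits.Parity.GeneralizedHardyLittlewood.Theorems.LiouvilleShiftedTablesTypeI2DilatedPeel2

/-!
# The peel, part 3/6: CRT, from blocks to the pair, and the main blocks via Theorem 5.1

Route `LiouvilleShiftedTables` (Parity / GeneralizedHardyLittlewood), crux `TypeI2Dilated` (stmt-Parity-14272),
line `peel-to-drappeau`, registered stub `stub_peel : PeelStep` (`PeelStep := DrappeauTypeII → DilatedTypeIICore`,
vocabulary in `…Theorems.LiouvilleShiftedTablesDefs`).  THE PEEL moves the two rough moduli
(`r` and the dilation `q`, both `≤ x^ρ`) and their classes onto the coefficients, so that Drappeau's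
hypothesis-free Theorem 5.1 (S. Drappeau, Proc. LMS 114 (2017), arXiv:1504.05549, §5 — the Literature named
fact `Drappeau2017_theorem51`, taken as the hypothesis `DrappeauTypeII`) applies on the smooth modulus `s` alone:
CRT class `e mod lcm(q, r)` → `g ∣ mh` × a unit class expanded in characters `ξ mod L'` (absorbed into `α`, `β`),
the `(qr)^∞`-part `h` of the `β`-variable split off (`h ≤ x^{6ρ₀}`: Theorem 5.1 at `x' = MN/h` with
`a₁ = c·qr`, `a₂ = h·qr`; `h > x^{6ρ₀}`: the trivial bound (5.2) and `∑_{h ∣ (qr)^∞} h^{-1/2} ≤ τ(qr)²`),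
`ρ₀ = min(δ_{5.1}(η/2), η)/100`.  Everything here is PROVED; the only non-Mathlib inputs are the Literature
lemmas `Literature.NumberTheory.Sieve.DrappeauDispersionLemmas` (all proved) and the divisor bound
(`DivisorBound`, `DivisorPowerSums`).

The chain (each file imports the previous one):
* part 1: the peeled objects and THE PEEL identity (`…TypeI2DilatedPeel1`)
* part 2: matching Theorem 5.1; bounds for the peeled coefficients and blocks (`…TypeI2DilatedPeel2`)
* part 3: CRT, from blocks to the pair, and the main blocks via Theorem 5.1 (`…TypeI2DilatedPeel3`)
* part 4: the per-pair bound (`…TypeI2DilatedPeel4`)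
* part 5: the crux sum at one height `x` (`…TypeI2DilatedPeel5`)
* part 6: constants, thresholds and `stub_peel` (`…TypeI2DilatedPeel6`)

[this line; cite: Drappeau2017, Thm 5.1, §5 (5.1)–(5.2)]
-/

noncomputable section

namespace Summit.Parity.GeneralizedHardyLittlewood.Cruxes.TypeI2Dilated.PeelToDrappeau

open Finset Real
open scoped ArithmeticFunction.sigma Classical
open Literature.NumberTheory.Sieve Literature.NumberTheory.Sieve.Drappeau2017

/-! ### CRT and the passage from blocks to the pair -/

/-- The crux's per-pair sum `T₀(q, r)` (the two class conditions `mn ≡ u (r)`, `mn ≡ v (q)`), literally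
the inner triple sum of `DilatedTypeIICore`. [this line] -/
def T0 (c : ℤ) (Rd : ℝ) (q r : ℕ) (Slo M N : ℝ) (α β : ℕ → ℂ) (u v : ℤ) : ℂ :=
  ∑ s ∈ sRange c q r Slo (2 * Slo), ∑ m ∈ BFI.dyadic M, ∑ n ∈ BFI.dyadic N,
    if ((m * n : ℕ) : ZMod r) = ((u : ℤ) : ZMod r) ∧ ((m * n : ℕ) : ZMod q) = ((v : ℤ) : ZMod q) then
      α m * β n * uR Rd s (((m * n : ℕ) : ZMod s) * ((c : ZMod s))⁻¹)
    else 0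

/-- **CRT step**: `T₀(q, r)` vanishes (incompatible classes) or equals `T_L` for the CRT class
`e mod lcm(q, r)`. [this line] -/
theorem T0_eq_zero_or (c : ℤ) (Rd : ℝ) (q r : ℕ) (Slo M N : ℝ) (α β : ℕ → ℂ) (u v : ℤ) :
    T0 c Rd q r Slo M N α β u v = 0 ∨
      ∃ e : ℕ, T0 c Rd q r Slo M N α β u v = TL c Rd q r Slo M N α β (Nat.lcm q r) e := by
  rcases crt_reduce (q := q) (r := r) u v with h | ⟨e, he⟩
  · left
    unfold T0
    refine Finset.sum_eq_zero fun s _ => Finset.sum_eq_zero fun m _ =>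
      Finset.sum_eq_zero fun n _ => ?_
    rw [if_neg (h (m * n))]
  · right
    refine ⟨e, ?_⟩
    unfold T0 TL Fker
    refine Finset.sum_congr rfl fun s _ => Finset.sum_congr rfl fun m _ =>
      Finset.sum_congr rfl fun n _ => ?_
    exact if_congr (he (m * n)) rfl rfl

/-- **From blocks to the pair**: if every peeled block of `h` is bounded by `b(h)` uniformly in the
twist `ξ mod L'`, then `‖T_L‖ ≤ ∑_h b(h)` (the `φ(L')` twists carry the weight `φ(L')⁻¹`).
[this line] -/
theorem norm_TL_le_sum (c : ℤ) (Rd : ℝ) {q r : ℕ} (hq : 0 < q) (hr : 0 < r) (Slo : ℝ) {M N : ℝ}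
    (hN : 0 ≤ N) (α β : ℕ → ℂ) {L e B : ℕ} (hLdef : L = Nat.lcm q r) (hB : ⌊2 * N⌋₊ ≤ B)
    (b : ℕ → ℝ)
    (hb : ∀ h ∈ hSet (q * r) B, ∀ ξ : DirichletCharacter ℂ (L / Nat.gcd e L),
      ‖∑ s ∈ sRange c q r Slo (2 * Slo),
          Eblock c Rd M N α β (q * r) (Nat.gcd e L) h (L / Nat.gcd e L) ξ s‖ ≤ b h) :
    ‖TL c Rd q r Slo M N α β L e‖ ≤ ∑ h ∈ hSet (q * r) B, b h := by
  have hL : 0 < L := by rw [hLdef]; exact Nat.lcm_pos hq hr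
  have hg0 : 0 < Nat.gcd e L := Nat.gcd_pos_of_pos_right _ hL
  have hL'0 : 0 < L / Nat.gcd e L :=
    Nat.div_pos (Nat.le_of_dvd hL (Nat.gcd_dvd_right e L)) hg0
  rw [TL_eq_sum c Rd hq hr Slo hN α β hLdef rfl rfl rfl hB]
  refine (norm_sum_le _ _).trans (Finset.sum_le_sum fun h hh => ?_)
  refine (norm_sum_le _ _).trans ?_
  have hφ : (0 : ℝ) < Nat.totient (L / Nat.gcd e L) := by exact_mod_cast Nat.totient_pos.2 hL'0
  have : ∀ ξ ∈ (Finset.univ : Finset (DirichletCharacter ℂ (L / Nat.gcd e L))),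
      ‖(((Nat.totient (L / Nat.gcd e L) : ℂ))⁻¹ *
            ξ (((e / Nat.gcd e L : ℕ) : ZMod (L / Nat.gcd e L)))⁻¹) *
          ∑ s ∈ sRange c q r Slo (2 * Slo),
            Eblock c Rd M N α β (q * r) (Nat.gcd e L) h (L / Nat.gcd e L) ξ s‖ ≤
        (Nat.totient (L / Nat.gcd e L) : ℝ)⁻¹ * b h := by
    intro ξ _
    rw [norm_mul, norm_mul, norm_inv, Complex.norm_natCast]
    refine mul_le_mul ?_ (hb h hh ξ) (norm_nonneg _) (by positivity)
    exact mul_le_of_le_one_right (by positivity) (ξ.norm_le_one _)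
  refine (Finset.sum_le_sum this).trans ?_
  rw [Finset.sum_const, nsmul_eq_mul, card_univ_dirichletCharacter hL'0, ← mul_assoc,
    mul_inv_cancel₀ hφ.ne', one_mul]

/-! ### The main blocks (`h ≤ H`) via Theorem 5.1 -/

section WithTheorem51

/-! The section hypothesis `h51`: Drappeau's Theorem 5.1 at fixed `(η₅, δ, K, C₅, c₀, x₅)` — literally the
inner statement of `Literature.NumberTheory.Sieve.Drappeau2017_theorem51` once its quantifiers
`∀ η ∃ δ ∀ A ∃ C c₀ x₀` are instantiated. -/

variable {η₅ δ K C₅ c₀ x₅ : ℝ}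
  (h51 : ∀ x : ℝ, x₅ ≤ x →
    ∀ M N S Rd : ℝ, M * N = x → x ^ η₅ ≤ N → N ≤ S ^ (2 / 3 - η₅) → x ^ (1 / 4 : ℝ) ≤ S →
      S ≤ x ^ (1 / 2 + δ) → 1 ≤ Rd → Rd ≤ x ^ δ →
    ∀ a₁ a₂ : ℤ, a₁ ≠ 0 → a₂ ≠ 0 → (|a₁| : ℝ) ≤ x ^ δ → (|a₂| : ℝ) ≤ x ^ δ →
    ∀ α β : ℕ → ℂ, (∀ m, ‖α m‖ ≤ (σ 0 m : ℝ) ^ K) → (∀ n, ‖β n‖ ≤ (σ 0 n : ℝ) ^ K) →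
      ‖∑ s ∈ (BFI.dyadic S).filter (fun s : ℕ => IsCoprime (s : ℤ) (a₁ * a₂)),
          ∑ m ∈ BFI.dyadic M, ∑ n ∈ (BFI.dyadic N).filter (fun n : ℕ => IsCoprime (n : ℤ) a₂),
            α m * β n *
              uR Rd s (((m * n : ℕ) : ZMod s) * ((a₁ : ZMod s))⁻¹ * ((a₂ : ZMod s)))‖ ≤
        C₅ * x * Real.log x ^ c₀ / Rd)
include h51

/-- **Main blocks** (`h ≤ H`): Theorem 5.1 bounds the peeled block,
`‖∑_s E(h, ξ, s)‖ ≤ τ(h)^K · C x' (log x')^{c₀}/Rd` with `x' = M N/h`, once its side conditions hold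
at `x'`. [this line; cite: Drappeau2017, Thm 5.1] -/
theorem main_block_bound (hK : 0 ≤ K)
    {c : ℤ} (hc : c ≠ 0) (Rd : ℝ) {q r : ℕ} (hq : 0 < q) (hr : 0 < r) {Slo : ℝ} (hSlo : 0 ≤ Slo)
    (M N : ℝ) {α β : ℕ → ℂ} (hα : ∀ m, ‖α m‖ ≤ (σ 0 m : ℝ) ^ K) (hβ : ∀ n, ‖β n‖ ≤ (σ 0 n : ℝ) ^ K)
    (g : ℕ) {h L' : ℕ} (hh : h ≠ 0) (hhS : h.primeFactors ⊆ (q * r).primeFactors)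
    (ξ : DirichletCharacter ℂ L')
    (h1 : x₅ ≤ M * (N / h)) (h2 : (M * (N / h)) ^ η₅ ≤ N / h) (h3 : N / h ≤ Slo ^ (2 / 3 - η₅))
    (h4 : (M * (N / h)) ^ (1 / 4 : ℝ) ≤ Slo) (h5 : Slo ≤ (M * (N / h)) ^ (1 / 2 + δ)) (h6 : 1 ≤ Rd)
    (h7 : Rd ≤ (M * (N / h)) ^ δ) (h8 : (|c| : ℝ) * ((q * r : ℕ) : ℝ) ≤ (M * (N / h)) ^ δ)
    (h9 : ((h * (q * r) : ℕ) : ℝ) ≤ (M * (N / h)) ^ δ) :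
    ‖∑ s ∈ sRange c q r Slo (2 * Slo), Eblock c Rd M N α β (q * r) g h L' ξ s‖ ≤
      (σ 0 h : ℝ) ^ K * (C₅ * (M * (N / h)) * Real.log (M * (N / h)) ^ c₀ / Rd) := by
  have hP0 : q * r ≠ 0 := (Nat.mul_pos hq hr).ne'
  set a₁ : ℤ := c * ((q * r : ℕ) : ℤ) with ha₁
  set a₂ : ℤ := ((h * (q * r) : ℕ) : ℤ) with ha₂
  rw [sum_Eblock_eq Rd hSlo M N α β hh hhS ξ K ha₁ ha₂, norm_mul]
  have hDnn : 0 ≤ (σ 0 h : ℝ) ^ K := (sigma_rpow_pos hh K).le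
  rw [Complex.norm_real, Real.norm_of_nonneg hDnn]
  refine mul_le_mul_of_nonneg_left ?_ hDnn
  refine h51 (M * (N / h)) h1 M (N / h) Slo Rd rfl h2 h3 h4 h5 h6 h7 a₁ a₂ ?_ ?_ ?_ ?_ _ _
    (fun m => (norm_aCoef_le _ _ _ _ _ m).trans (hα m)) (fun n => norm_bCoefN_le hK hβ hh _ _ n)
  · exact mul_ne_zero hc (by exact_mod_cast hP0)
  · rw [ha₂]; exact_mod_cast mul_ne_zero hh hP0
  · rw [ha₁, Int.cast_mul, abs_mul, Int.cast_natCast, Nat.abs_cast]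
    exact h8
  · rw [ha₂, Int.cast_natCast, Nat.abs_cast]
    exact h9

end WithTheorem51

/-- Landing anchor of the split peel chain (file 3 of 6): a registered, mathematically vacuous sub-goal
(`ledger workitem stub-add … --name peelChain3_anchor --signature 'True'`) so that this intermediate file passes
the gate's supports check; the registered stub `stub_peel` is proved in file 6. [this line] -/
theorem peelChain3_anchor : True := trivial

end Summit.Parity.GeneralizedHardyLittlewood.Cruxes.TypeI2Dilated.PeelToDrappeau

end
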